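import Summits.Langlands.Statement
import HarnessLib

/-!
# Birth skeleton (BC3) for the child `SatakeAvatarExistence` (W⁺ = item stmt-Langlands-17415) of the split of
`FifteenLocusEisenstein.SectorComplement` (stmt-Langlands-16058) — line `birth16058_SatakeAvatarExistence`

W⁺ ("every L-algebraic cuspidal `π` of `GL_n(𝔸_K)` has an IRREDUCIBLE `ℓ`-adic avatar Satake–Frobenius compatible a.e.")
from two genuine lemmas:

* `stub_weakExistence` (W) — Buzzard–Gee Conj. 3.2.2, weak form: SOME avatar, unramified a.e., de Rham above `ℓ` for
  Fontaine's pinned datum, Satake–Frobenius compatible a.e. (VERBATIM the text `CapacityClassicality.WeakExistence` /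
  `Cruxes/SectorComplement/Lines/birth*.lean: stub_weakExistence`; THEOREM for regular algebraic `π` over CM / totally
  real `K` — HLTT 2016 Thm. A, Scholze 2015 V.4.2, de Rham by A'Campo 2024 / Caraiani–Newton — open for irregular `π`
  (NonRegularWeightBarrier) and general `K` (ShimuraVarietyRealizationBarrier));
* `stub_cuspidalAvatarIrreducible` (I) — Ramakrishnan's problem: a GEOMETRIC avatar of a CUSPIDAL `π` is irreducible
  (Ramakrishnan 2008 §0; Calegari–Gee 2013: `n ≤ 5` regular over totally real; Patrikis–Taylor / Xia / Böckle–Hui: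
  density-one `ℓ` in polarised regular cases).  IN THE TREE it follows from B_w (Fontaine–Mazur–Langlands a.e.) and
  Arthur–Clozel (2.2)–(2.3) by the ISOBARIC BOOTSTRAP (landed: `ReciprocityUpToIrreducibility.stub_geometricConstituents`
  p99702 + `stub_deRhamBlocks` p98936 + `stub_isobaricRigidity` p105601) — that is this stub's own sub-plan.

Composition `SatakeAvatarExistence_of : W → I → W⁺` (take W's avatar; it is irreducible by I).  Conclusion stated as the
TEXT of W⁺ (= the child decl by `Iff.rfl` once the split is rendered; = `PrimeSwitchSplit.SatakeAvatarExistence` today).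
Imports `Summits.Langlands.Statement` only.  Sorries: exactly the two stubs.
-/

noncomputable section

set_option linter.dupNamespace false

open scoped NumberField Classical Polynomial
open Filter IsDedekindDomain Polynomial
open Literature.NumberTheory.Automorphic Literature.NumberTheory.GaloisRepresentations
open Summit.Langlands

namespace Summit.Langlands.Langlands.Cruxes.SectorComplement.Birth16058SatakeAvatarExistence

/-- **stub W — weak existence** (Buzzard–Gee Conj. 3.2.2, weak form). [cite: BuzzardGeeLMS2014, Conj. 3.2.2] -/
theorem stub_weakExistence : ∀ (K : Type) [Field K] [NumberField K] (n : ℕ) (hcpt : Literature.NumberTheory.Automorphic.isCompact_glFiniteIntegralLevel n K), 0 < n → ∀ π : Literature.NumberTheory.Automorphic.CuspidalAutomorphicRepData n K hcpt, π.1.IsLAlgebraic → ∀ (ℓ : ℕ) [Fact ℓ.Prime] (ι : PadicAlgCl ℓ ≃+* ℂ), ∃ ρ : Literature.NumberTheory.GaloisRepresentations.FramedGaloisRep K (PadicAlgCl ℓ) n, ((∀ᶠ v : IsDedekindDomain.HeightOneSpectrum (NumberField.RingOfIntegers K) in cofinite, ρ.IsUnramifiedAt v) ∧ ∀ (v : IsDedekindDomain.HeightOneSpectrum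 (NumberField.RingOfIntegers K)) (hv : ((ℓ : ℕ) : NumberField.RingOfIntegers K) ∈ v.asIdeal), (Literature.NumberTheory.PAdicHodge.fontainePstAdicCompletion v ℓ hv).IsDeRhamFramed (ρ.toLocal v)) ∧ ∀ᶠ v : IsDedekindDomain.HeightOneSpectrum (NumberField.RingOfIntegers K) in cofinite, SatakeFrobCompatibleAt ι π.1 ρ v := by
  sorry

/-- **stub I — a geometric avatar of a cuspidal `π` is irreducible** (Ramakrishnan; in the tree ⟸ B_w + AC (2.2)–(2.3) by the
isobaric bootstrap). [cite: CalegariGee2013, §1.1] -/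
theorem stub_cuspidalAvatarIrreducible : ∀ (K : Type) [Field K] [NumberField K] (n : ℕ) (hcpt : Literature.NumberTheory.Automorphic.isCompact_glFiniteIntegralLevel n K), 0 < n → ∀ (π : Literature.NumberTheory.Automorphic.CuspidalAutomorphicRepData n K hcpt), π.1.IsLAlgebraic → ∀ (ℓ : ℕ) [Fact ℓ.Prime] (ι : PadicAlgCl ℓ ≃+* ℂ) (ρ : Literature.NumberTheory.GaloisRepresentations.FramedGaloisRep K (PadicAlgCl ℓ) n), ((∀ᶠ v : IsDedekindDomain.HeightOneSpectrum (NumberField.RingOfIntegers K) in cofinite, ρ.IsUnramifiedAt v) ∧ ∀ (v : IsDedekindDomain.HeightOneSpectrum (NumberField.RingOfIntegers K)) (hv : ((ℓ : ℕ) : NumberField.RingOfIntegers K) ∈ v.asIdeal), (Literature.NumberTheory.PAdicHodge.fontainePstAdicCompletion v ℓ hv).IsDeRhamFramed (ρ.toLocal v)) → (∀ᶠ v : IsDedekindDomain.HeightOneSpectrum (NumberField.RingOfIntegers K) in cofinite, SatakeFrobCompatibleAt ι π.1 ρ v) → ρ.toGaloisRep.IsIrreducible := by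
  sorry

/-- **W⁺ from W and I.** [folklore] -/
theorem SatakeAvatarExistence_of :
    (∀ (K : Type) [Field K] [NumberField K] (n : ℕ) (hcpt : Literature.NumberTheory.Automorphic.isCompact_glFiniteIntegralLevel n K), 0 < n → ∀ π : Literature.NumberTheory.Automorphic.CuspidalAutomorphicRepData n K hcpt, π.1.IsLAlgebraic → ∀ (ℓ : ℕ) [Fact ℓ.Prime] (ι : PadicAlgCl ℓ ≃+* ℂ), ∃ ρ : Literature.NumberTheory.GaloisRepresentations.FramedGaloisRep K (PadicAlgCl ℓ) n, ((∀ᶠ v : IsDedekindDomain.HeightOneSpectrum (NumberField.RingOfIntegers K) in cofinite, ρ.IsUnramifiedAt v) ∧ ∀ (v : IsDedekindDomain.HeightOneSpectrum (NumberField.RingOfIntegers K)) (hv : ((ℓ : ℕ) : NumberField.RingOfIntegers K) ∈ v.asIdeal), (Literature.NumberTheory.PAdicHodge.fontainePstAdicCompletion v ℓ hv).IsDeRhamFramed (ρ.toLocal v)) ∧ ∀ᶠ v : IsDedekindDomain.HeightOneSpectrum (NumberField.RingOfIntegers K) in cofinite, SatakeFrobCompatibleAt ι π.1 ρ v) →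
    (∀ (K : Type) [Field K] [NumberField K] (n : ℕ) (hcpt : Literature.NumberTheory.Automorphic.isCompact_glFiniteIntegralLevel n K), 0 < n → ∀ (π : Literature.NumberTheory.Automorphic.CuspidalAutomorphicRepData n K hcpt), π.1.IsLAlgebraic → ∀ (ℓ : ℕ) [Fact ℓ.Prime] (ι : PadicAlgCl ℓ ≃+* ℂ) (ρ : Literature.NumberTheory.GaloisRepresentations.FramedGaloisRep K (PadicAlgCl ℓ) n), ((∀ᶠ v : IsDedekindDomain.HeightOneSpectrum (NumberField.RingOfIntegers K) in cofinite, ρ.IsUnramifiedAt v) ∧ ∀ (v : IsDedekindDomain.HeightOneSpectrum (NumberField.RingOfIntegers K)) (hv : ((ℓ : ℕ) : NumberField.RingOfIntegers K) ∈ v.asIdeal), (Literature.NumberTheory.PAdicHodge.fontainePstAdicCompletion v ℓ hv).IsDeRhamFramed (ρ.toLocal v)) → (∀ᶠ v : IsDedekindDomain.HeightOneSpectrum (NumberField.RingOfIntegers K) in cofinite, SatakeFrobCompatibleAt ι π.1 ρ v) → ρ.toGaloisRep.IsIrreducible) →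
    (∀ (K : Type) [Field K] [NumberField K] (n : ℕ) (hcpt : Literature.NumberTheory.Automorphic.isCompact_glFiniteIntegralLevel n K), 0 < n → ∀ (π : Literature.NumberTheory.Automorphic.CuspidalAutomorphicRepData n K hcpt), π.1.IsLAlgebraic → ∀ (ℓ : ℕ) [Fact ℓ.Prime] (ι : PadicAlgCl ℓ ≃+* ℂ), ∃ ρ : Literature.NumberTheory.GaloisRepresentations.FramedGaloisRep K (PadicAlgCl ℓ) n, ρ.toGaloisRep.IsIrreducible ∧ ∀ᶠ v : IsDedekindDomain.HeightOneSpectrum (NumberField.RingOfIntegers K) in cofinite, SatakeFrobCompatibleAt ι π.1 ρ v) := by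
  intro hW hI K _ _ n hcpt hn π hπ ℓ _ ι
  obtain ⟨ρ, hgeo, hρ⟩ := hW K n hcpt hn π hπ ℓ ι
  exact ⟨ρ, hI K n hcpt hn π hπ ℓ ι ρ hgeo hρ, hρ⟩

/-- W⁺ (text) from the stubs. -/
theorem SatakeAvatarExistence_of_stubs : ∀ (K : Type) [Field K] [NumberField K] (n : ℕ) (hcpt : Literature.NumberTheory.Automorphic.isCompact_glFiniteIntegralLevel n K), 0 < n → ∀ (π : Literature.NumberTheory.Automorphic.CuspidalAutomorphicRepData n K hcpt), π.1.IsLAlgebraic → ∀ (ℓ : ℕ) [Fact ℓ.Prime] (ι : PadicAlgCl ℓ ≃+* ℂ), ∃ ρ : Literature.NumberTheory.GaloisRepresentations.FramedGaloisRep K (PadicAlgCl ℓ) n, ρ.toGaloisRep.IsIrreducible ∧ ∀ᶠ v : IsDedekindDomain.HeightOneSpectrum (NumberField.RingOfIntegers K) in cofinite, SatakeFrobCompatibleAt ι π.1 ρ v :=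
  SatakeAvatarExistence_of stub_weakExistence stub_cuspidalAvatarIrreducible

end Summit.Langlands.Langlands.Cruxes.SectorComplement.Birth16058SatakeAvatarExistence

end
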